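import Summits.Ventures.YMGap.RobustBall.HaarSecondMoments
import HarnessLib

/-!
# Character convolution identities for `G ≅ SU(N)` (gauge-boot, task L3(ξ), 2/5)

HONEST FRAMING (cell `pub-gaugeboot`, page 1 of every file): the venture produces certified bounds
on lattice expectations at stated coupling, gauge group, dimension and torus size; NOT a mass gap,
NOT a continuum limit, NOT a string tension; NOT Yang–Mills-summit-bearing (barriers
`FixedCouplingUltralocality`, `PerturbativeInvisibility`). This module is compact-group
integration feeding the structural NEGATIVE result `DiagonalRPTorusNegativeOddSUN` (closed-half
diagonal RP fails on odd three-tori for `G ≅ SU(N)` at small coupling); it discharges nothing else.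

## Content (`G ≅ SU(N)` through `IsSpecialUnitaryModel ρ`, `χ = tr ρ` the fundamental character)

From the quadratic Haar moments `∫ ρ(g)_{ab} conj ρ(g)_{cd} dg = δ_{ac} δ_{bd}/N` of the tree
(`Summit.Ventures.YMGap.RobustBall.HaarSecondMoments.integral_entry_mul_conj_entry`):

* `exists_smul_one` — a centre element: `ρ z = ω • 1` with `ω = e^{2πi/N} ≠ 1` (`N ≥ 2`);
* `map_inv_eq_star` — `ρ(g⁻¹) = ρ(g)^*`;
* `integral_sum_entry_mul_conj_entry` / `integral_sum_entry_mul_conj_entry'` — the contraction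
  rules `∫ Σ c_{pqrs} ρ_{pq} conj ρ_{rs} = N⁻¹ Σ_{pq} c_{pqpq}` and
  `∫ Σ c_{pqrs} ρ_{ps} conj ρ_{qr} = N⁻¹ Σ_{ps} c_{ppss}`;
* `integral_trace_mul_inv_mul_trace_mul` — the CONVOLUTION identity
  `∫ χ(x g⁻¹) χ(g y) dg = χ(x y)/N`;
* `integral_trace_conj_mul` — the CLASS identity `∫ χ(g x g⁻¹ y) dg = χ(x) χ(y)/N`, and its
  real part `integral_re_trace_conj_mul`: `∫ Re χ(g x g⁻¹ y) dg = Re(χ(x) χ(y))/N`;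
* `integral_entry_mul_entry_eq_zero` — `∫ ρ_{ab} ρ_{cd} = 0` for `N ≥ 3` (centre twist, `ω² ≠ 1`);
* `exists_re_conv_const` — the REAL convolution identity
  `∫ Re χ(x g⁻¹) Re χ(g y) dg = c₁ Re χ(x y)` with `c₁ = 1/2` for `N = 2` (real character) and
  `c₁ = 1/(2N)` for `N ≥ 3` (complex type), packaged as `∃ c₁ > 0`.

Folklore (Schur orthogonality for the fundamental representation; e.g. M. Creutz, *Quarks, gluons
and lattices* (1983) §8 (8.19)–(8.22)); everything is proved, no definition, no named fact.
-/

noncomputable section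

open MeasureTheory Complex Finset
open Literature.MathematicalPhysics.QuantumFieldTheory
open Summit.Ventures.YMGap.RobustBall.HaarSecondMoments

namespace Summit.QuantumFields.GaugeBoot

namespace DiagRPSUN

variable {N : ℕ} {G : Type*} [Group G] [TopologicalSpace G] [IsTopologicalGroup G] [CompactSpace G]
  [MeasurableSpace G] [BorelSpace G] (ρ : G →* Matrix (Fin N) (Fin N) ℂ)

/-! ## Centre, unitarity, integrability -/

omit [IsTopologicalGroup G] [CompactSpace G] [MeasurableSpace G] [BorelSpace G] in
/-- **A non-trivial centre element**: for `G ≅ SU(N)`, `N ≥ 2`, some `z : G` has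
`ρ z = ω • 1` with `ω = e^{2πi/N} ≠ 1`. -/
theorem exists_smul_one (hρ : IsSpecialUnitaryModel ρ) (hN : 2 ≤ N) :
    ∃ z : G, ∃ ω : ℂ, ω ≠ 1 ∧ ρ z = ω • (1 : Matrix (Fin N) (Fin N) ℂ) := by
  have hN0 : N ≠ 0 := by omega
  set ζ : ℂ := Complex.exp (2 * Real.pi * Complex.I / N) with hζ
  have hprim : IsPrimitiveRoot ζ N := Complex.isPrimitiveRoot_exp N hN0
  have hmem : ζ • (1 : Matrix (Fin N) (Fin N) ℂ) ∈ Matrix.specialUnitaryGroup (Fin N) ℂ := by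
    rw [hζ]; exact smul_one_mem (N := N) hN0
  obtain ⟨z, hz⟩ := exists_eq_of_mem ρ hρ hmem
  exact ⟨z, ζ, hprim.ne_one (by omega), hz⟩

omit [IsTopologicalGroup G] [CompactSpace G] [MeasurableSpace G] [BorelSpace G] in
/-- `ρ(g⁻¹) = ρ(g)^*` for a special unitary model. -/
theorem map_inv_eq_star (hρ : IsSpecialUnitaryModel ρ) (g : G) : ρ g⁻¹ = star (ρ g) := by
  have hu := IsSpecialUnitaryModel.mem_unitaryGroup ρ hρ g
  rw [Matrix.mem_unitaryGroup_iff] at hu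
  have h1 : ρ g⁻¹ * ρ g = 1 := by rw [← map_mul, inv_mul_cancel, map_one]
  calc ρ g⁻¹ = ρ g⁻¹ * (ρ g * star (ρ g)) := by rw [hu, mul_one]
    _ = star (ρ g) := by rw [← mul_assoc, h1, one_mul]

/-- Continuous functions on the compact group are Haar integrable. -/
theorem integrable_of_continuous {E : Type*} [NormedAddCommGroup E] {f : G → E}
    (hf : Continuous f) : Integrable f (haarProbability G) :=
  hf.integrable_of_hasCompactSupport (HasCompactSupport.of_compactSpace _)

/-! ## The contraction rules -/

/-- **Contraction rule** (linear extension of the quadratic moments): for every coefficient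
tensor `c`, `∫ Σ_{pqrs} c_{pqrs} ρ(g)_{pq} conj ρ(g)_{rs} dg = N⁻¹ Σ_{pq} c_{pqpq}`. -/
theorem integral_sum_entry_mul_conj_entry (hρ : IsSpecialUnitaryModel ρ)
    (c : Fin N → Fin N → Fin N → Fin N → ℂ) :
    ∫ g, ∑ p, ∑ q, ∑ r, ∑ s, c p q r s * (ρ g p q * (starRingEnd ℂ) (ρ g r s))
        ∂haarProbability G = (N : ℂ)⁻¹ * ∑ p, ∑ q, c p q p q := by
  have hI : ∀ p q r s, Integrable (fun g => c p q r s * (ρ g p q * (starRingEnd ℂ) (ρ g r s)))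
      (haarProbability G) := fun p q r s =>
    (integrable_entry_mul_conj_entry ρ hρ.1 p q r s).const_mul _
  have step : ∀ p q, ∫ g, ∑ r, ∑ s, c p q r s * (ρ g p q * (starRingEnd ℂ) (ρ g r s))
      ∂haarProbability G = (N : ℂ)⁻¹ * c p q p q := by
    intro p q
    rw [integral_finsetSum _ fun r _ => integrable_finsetSum _ fun s _ => hI p q r s]
    simp_rw [integral_finsetSum _ fun s _ => hI p q _ s, integral_const_mul,
      integral_entry_mul_conj_entry ρ hρ]
    have hr : ∀ r ∈ (univ : Finset (Fin N)), r ≠ p →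
        ∑ s, c p q r s * (if p = r ∧ q = s then ((N : ℂ))⁻¹ else 0) = 0 := by
      intro r _ hr
      exact Finset.sum_eq_zero fun s _ => by rw [if_neg (fun h => hr h.1.symm), mul_zero]
    rw [Finset.sum_eq_single_of_mem p (mem_univ p) hr]
    have hs : ∀ s ∈ (univ : Finset (Fin N)), s ≠ q →
        c p q p s * (if p = p ∧ q = s then ((N : ℂ))⁻¹ else 0) = 0 := by
      intro s _ hs
      rw [if_neg (fun h => hs h.2.symm), mul_zero]
    rw [Finset.sum_eq_single_of_mem q (mem_univ q) hs, if_pos ⟨rfl, rfl⟩, mul_comm]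
  rw [integral_finsetSum _ fun p _ => integrable_finsetSum _ fun q _ =>
    integrable_finsetSum _ fun r _ => integrable_finsetSum _ fun s _ => hI p q r s]
  simp_rw [integral_finsetSum _ fun q _ => integrable_finsetSum _ fun r _ =>
    integrable_finsetSum _ fun s _ => hI _ q r s, step, ← Finset.mul_sum]

/-- **Contraction rule, second index pattern**:
`∫ Σ_{pqrs} c_{pqrs} ρ(g)_{ps} conj ρ(g)_{qr} dg = N⁻¹ Σ_{ps} c_{ppss}`. -/
theorem integral_sum_entry_mul_conj_entry' (hρ : IsSpecialUnitaryModel ρ)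
    (c : Fin N → Fin N → Fin N → Fin N → ℂ) :
    ∫ g, ∑ p, ∑ q, ∑ r, ∑ s, c p q r s * (ρ g p s * (starRingEnd ℂ) (ρ g q r))
        ∂haarProbability G = (N : ℂ)⁻¹ * ∑ p, ∑ s, c p p s s := by
  have hI : ∀ p q r s, Integrable (fun g => c p q r s * (ρ g p s * (starRingEnd ℂ) (ρ g q r)))
      (haarProbability G) := fun p q r s =>
    (integrable_entry_mul_conj_entry ρ hρ.1 p s q r).const_mul _
  have step : ∀ p, ∫ g, ∑ q, ∑ r, ∑ s, c p q r s * (ρ g p s * (starRingEnd ℂ) (ρ g q r))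
      ∂haarProbability G = (N : ℂ)⁻¹ * ∑ s, c p p s s := by
    intro p
    rw [integral_finsetSum _ fun q _ => integrable_finsetSum _ fun r _ =>
      integrable_finsetSum _ fun s _ => hI p q r s]
    simp_rw [integral_finsetSum _ fun r _ => integrable_finsetSum _ fun s _ => hI p _ r s,
      integral_finsetSum _ fun s _ => hI p _ _ s, integral_const_mul,
      integral_entry_mul_conj_entry ρ hρ]
    have hq : ∀ q ∈ (univ : Finset (Fin N)), q ≠ p →
        ∑ r, ∑ s, c p q r s * (if p = q ∧ s = r then ((N : ℂ))⁻¹ else 0) = 0 := by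
      intro q _ hq
      exact Finset.sum_eq_zero fun r _ => Finset.sum_eq_zero fun s _ => by
        rw [if_neg (fun h => hq h.1.symm), mul_zero]
    rw [Finset.sum_eq_single_of_mem p (mem_univ p) hq, Finset.mul_sum]
    refine Finset.sum_comm.trans (Finset.sum_congr rfl fun s _ => ?_)
    have hr : ∀ r ∈ (univ : Finset (Fin N)), r ≠ s →
        c p p r s * (if p = p ∧ s = r then ((N : ℂ))⁻¹ else 0) = 0 := by
      intro r _ hr
      rw [if_neg (fun h => hr h.2.symm), mul_zero]
    rw [Finset.sum_eq_single_of_mem s (mem_univ s) hr, if_pos ⟨rfl, rfl⟩, mul_comm]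
  rw [integral_finsetSum _ fun p _ => integrable_finsetSum _ fun q _ =>
    integrable_finsetSum _ fun r _ => integrable_finsetSum _ fun s _ => hI p q r s]
  simp_rw [step, ← Finset.mul_sum]

/-! ## Convolution and class identities -/

omit [TopologicalSpace G] [IsTopologicalGroup G] [CompactSpace G] [MeasurableSpace G]
  [BorelSpace G] in
/-- `tr(X M^*) tr(M Y)` as a contraction (in the summation order `simp` produces). -/
theorem trace_mul_star_mul_trace_mul (X M Y : Matrix (Fin N) (Fin N) ℂ) :
    (X * star M).trace * (M * Y).trace =
      ∑ p, ∑ q, ∑ r, ∑ s, (X r s * Y q p) * (M p q * (starRingEnd ℂ) (M r s)) := by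
  simp only [Matrix.trace, Matrix.diag_apply, Matrix.mul_apply, Matrix.star_apply,
    Complex.star_def, Finset.sum_mul, Finset.mul_sum]
  exact Finset.sum_congr rfl fun p _ => Finset.sum_congr rfl fun q _ =>
    Finset.sum_congr rfl fun r _ => Finset.sum_congr rfl fun s _ => by ring

omit [TopologicalSpace G] [IsTopologicalGroup G] [CompactSpace G] [MeasurableSpace G]
  [BorelSpace G] in
/-- `tr(M X M^* Y)` as a contraction (in the summation order `simp` produces). -/
theorem trace_mul_mul_star_mul (X M Y : Matrix (Fin N) (Fin N) ℂ) :
    (M * X * star M * Y).trace =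
      ∑ p, ∑ q, ∑ r, ∑ s, (X s r * Y q p) * (M p s * (starRingEnd ℂ) (M q r)) := by
  simp only [Matrix.trace, Matrix.diag_apply, Matrix.mul_apply, Matrix.star_apply,
    Complex.star_def, Finset.sum_mul]
  exact Finset.sum_congr rfl fun p _ => Finset.sum_congr rfl fun q _ =>
    Finset.sum_congr rfl fun r _ => Finset.sum_congr rfl fun s _ => by ring

/-- **Convolution identity** `∫ χ(x g⁻¹) χ(g y) dg = χ(x y)/N` (`G ≅ SU(N)`). -/
theorem integral_trace_mul_inv_mul_trace_mul (hρ : IsSpecialUnitaryModel ρ) (x y : G) :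
    ∫ g, (ρ (x * g⁻¹)).trace * (ρ (g * y)).trace ∂haarProbability G =
      (N : ℂ)⁻¹ * (ρ (x * y)).trace := by
  simp_rw [map_mul, map_inv_eq_star ρ hρ, trace_mul_star_mul_trace_mul,
    integral_sum_entry_mul_conj_entry ρ hρ]
  congr 1

/-- **Class identity** `∫ χ(g x g⁻¹ y) dg = χ(x) χ(y)/N` (`G ≅ SU(N)`). -/
theorem integral_trace_conj_mul (hρ : IsSpecialUnitaryModel ρ) (x y : G) :
    ∫ g, (ρ (g * x * g⁻¹ * y)).trace ∂haarProbability G =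
      (N : ℂ)⁻¹ * ((ρ x).trace * (ρ y).trace) := by
  simp_rw [map_mul, map_inv_eq_star ρ hρ, trace_mul_mul_star_mul,
    integral_sum_entry_mul_conj_entry' ρ hρ]
  congr 1
  simp only [Matrix.trace, Matrix.diag_apply, Finset.sum_mul, Finset.mul_sum]

/-- **Real class identity** `∫ Re χ(g x g⁻¹ y) dg = Re(χ(x) χ(y))/N` (`G ≅ SU(N)`). -/
theorem integral_re_trace_conj_mul (hρ : IsSpecialUnitaryModel ρ) (x y : G) :
    ∫ g, ((ρ (g * x * g⁻¹ * y)).trace).re ∂haarProbability G =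
      (N : ℝ)⁻¹ * ((ρ x).trace * (ρ y).trace).re := by
  have hc : Continuous fun g : G => (ρ (g * x * g⁻¹ * y)).trace :=
    hρ.1.matrix_trace.comp (((continuous_id.mul continuous_const).mul continuous_inv).mul
      continuous_const)
  have h := integral_trace_conj_mul ρ hρ x y
  have hre := integral_re (𝕜 := ℂ) (integrable_of_continuous hc)
  simp only [RCLike.re_to_complex] at hre
  rw [hre, h, Complex.mul_re, Complex.inv_re, Complex.inv_im, Complex.natCast_re,
    Complex.natCast_im, Complex.normSq_natCast]
  by_cases hN : (N : ℝ) = 0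
  · simp [hN]
  · field_simp
    ring

/-! ## The real convolution identity: `N = 2` and `N ≥ 3` -/

/-- **`∫ ρ_{ab} ρ_{cd} = 0` for `N ≥ 3`** (centre twist by `ζ • 1`, `ζ = e^{2πi/N}`, `ζ² ≠ 1`). -/
theorem integral_entry_mul_entry_eq_zero (hρ : IsSpecialUnitaryModel ρ) (hN : 3 ≤ N)
    (a b i j : Fin N) : ∫ g, ρ g a b * ρ g i j ∂haarProbability G = 0 := by
  set ζ : ℂ := Complex.exp (2 * Real.pi * Complex.I / N) with hζdef
  have hN0 : N ≠ 0 := by omega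
  have hprim : IsPrimitiveRoot ζ N := Complex.isPrimitiveRoot_exp N hN0
  have hζ2 : ζ ^ 2 ≠ 1 := fun h => by
    have := Nat.le_of_dvd two_pos ((hprim.pow_eq_one_iff_dvd 2).mp h); omega
  have hmem : ζ • (1 : Matrix (Fin N) (Fin N) ℂ) ∈ Matrix.specialUnitaryGroup (Fin N) ℂ := by
    rw [hζdef]; exact smul_one_mem (N := N) hN0
  have h := integral_comp_mul_left ρ hρ hmem (fun M => M a b * M i j)
  have ht : ∀ M : Matrix (Fin N) (Fin N) ℂ,
      (ζ • (1 : Matrix (Fin N) (Fin N) ℂ) * M) a b * (ζ • (1 : Matrix (Fin N) (Fin N) ℂ) * M) i j =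
        ζ ^ 2 * (M a b * M i j) := fun M => by
    rw [smul_mul_assoc, one_mul, Matrix.smul_apply, Matrix.smul_apply, smul_eq_mul, smul_eq_mul]
    ring
  simp only [ht] at h
  rw [integral_const_mul] at h
  set J : ℂ := ∫ g, ρ g a b * ρ g i j ∂haarProbability G
  have h2 : (ζ ^ 2 - 1) * J = 0 := by rw [sub_mul, one_mul, h, sub_self]
  rcases mul_eq_zero.mp h2 with h' | h'
  · exact absurd (sub_eq_zero.mp h') hζ2
  · exact h'

/-- For `N ≥ 3` the "unconjugated" pairing vanishes: `∫ χ(x g⁻¹) conj χ(g y) dg = 0`. -/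
theorem integral_trace_mul_inv_mul_conj_trace_mul (hρ : IsSpecialUnitaryModel ρ) (hN : 3 ≤ N)
    (x y : G) :
    ∫ g, (ρ (x * g⁻¹)).trace * (starRingEnd ℂ) (ρ (g * y)).trace ∂haarProbability G = 0 := by
  have hexp : ∀ g : G, (ρ (x * g⁻¹)).trace * (starRingEnd ℂ) (ρ (g * y)).trace =
      ∑ p, ∑ q, ∑ r, ∑ s, (ρ x r s * (starRingEnd ℂ) (ρ y q p)) *
        (starRingEnd ℂ) (ρ g p q * ρ g r s) := by
    intro g
    rw [map_mul, map_mul, map_inv_eq_star ρ hρ]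
    simp only [Matrix.trace, Matrix.diag_apply, Matrix.mul_apply, Matrix.star_apply,
      Complex.star_def, map_sum, map_mul, Finset.sum_mul, Finset.mul_sum]
    exact Finset.sum_congr rfl fun p _ => Finset.sum_congr rfl fun q _ =>
      Finset.sum_congr rfl fun r _ => Finset.sum_congr rfl fun s _ => by ring
  have hI : ∀ p q r s, Integrable (fun g => (ρ x r s * (starRingEnd ℂ) (ρ y q p)) *
      (starRingEnd ℂ) (ρ g p q * ρ g r s)) (haarProbability G) := fun p q r s =>
    (integrable_of_continuous (Complex.continuous_conj.comp
      ((hρ.1.matrix_elem p q).mul (hρ.1.matrix_elem r s)))).const_mul _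
  simp_rw [hexp]
  rw [integral_finsetSum _ fun p _ => integrable_finsetSum _ fun q _ =>
    integrable_finsetSum _ fun r _ => integrable_finsetSum _ fun s _ => hI p q r s]
  refine Finset.sum_eq_zero fun p _ => ?_
  rw [integral_finsetSum _ fun q _ => integrable_finsetSum _ fun r _ =>
    integrable_finsetSum _ fun s _ => hI p q r s]
  refine Finset.sum_eq_zero fun q _ => ?_
  rw [integral_finsetSum _ fun r _ => integrable_finsetSum _ fun s _ => hI p q r s]
  refine Finset.sum_eq_zero fun r _ => ?_
  rw [integral_finsetSum _ fun s _ => hI p q r s]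
  refine Finset.sum_eq_zero fun s _ => ?_
  rw [integral_const_mul, integral_conj, integral_entry_mul_entry_eq_zero ρ hρ hN, map_zero,
    mul_zero]

omit [CompactSpace G] [MeasurableSpace G] [BorelSpace G] in
/-- The integrand of the real convolution identity is continuous. -/
theorem continuous_re_trace_mul_inv_mul (hρ : Continuous ρ) (x y : G) :
    Continuous fun g : G => ((ρ (x * g⁻¹)).trace).re * ((ρ (g * y)).trace).re :=
  (Complex.continuous_re.comp (hρ.matrix_trace.comp (continuous_const.mul continuous_inv))).mul
    (Complex.continuous_re.comp (hρ.matrix_trace.comp (continuous_id.mul continuous_const)))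

/-- **Real convolution identity, `N ≥ 3`**: `∫ Re χ(x g⁻¹) Re χ(g y) dg = Re χ(x y)/(2N)`. -/
theorem integral_re_trace_mul_inv_mul_of_three_le (hρ : IsSpecialUnitaryModel ρ) (hN : 3 ≤ N)
    (x y : G) :
    ∫ g, ((ρ (x * g⁻¹)).trace).re * ((ρ (g * y)).trace).re ∂haarProbability G =
      (2 * N : ℝ)⁻¹ * ((ρ (x * y)).trace).re := by
  -- `Re u Re v = (Re(u v) + Re(u conj v))/2`
  have hpt : ∀ g : G, ((ρ (x * g⁻¹)).trace).re * ((ρ (g * y)).trace).re =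
      (((ρ (x * g⁻¹)).trace * (ρ (g * y)).trace).re +
        ((ρ (x * g⁻¹)).trace * (starRingEnd ℂ) (ρ (g * y)).trace).re) / 2 := fun g => by
    simp only [Complex.mul_re, Complex.conj_re, Complex.conj_im]
    ring
  have hc1 : Continuous fun g : G => (ρ (x * g⁻¹)).trace * (ρ (g * y)).trace :=
    (hρ.1.matrix_trace.comp (continuous_const.mul continuous_inv)).mul
      (hρ.1.matrix_trace.comp (continuous_id.mul continuous_const))
  have hc2 : Continuous fun g : G => (ρ (x * g⁻¹)).trace * (starRingEnd ℂ) (ρ (g * y)).trace :=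
    (hρ.1.matrix_trace.comp (continuous_const.mul continuous_inv)).mul
      (Complex.continuous_conj.comp (hρ.1.matrix_trace.comp (continuous_id.mul continuous_const)))
  have hre1 := integral_re (𝕜 := ℂ) (integrable_of_continuous hc1)
  have hre2 := integral_re (𝕜 := ℂ) (integrable_of_continuous hc2)
  simp only [RCLike.re_to_complex] at hre1 hre2
  have hi1 : Integrable (fun g : G => ((ρ (x * g⁻¹)).trace * (ρ (g * y)).trace).re)
      (haarProbability G) := integrable_of_continuous (Complex.continuous_re.comp hc1)
  have hi2 : Integrable
      (fun g : G => ((ρ (x * g⁻¹)).trace * (starRingEnd ℂ) (ρ (g * y)).trace).re)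
      (haarProbability G) := integrable_of_continuous (Complex.continuous_re.comp hc2)
  simp_rw [hpt]
  rw [integral_div, integral_add hi1 hi2, hre1, hre2, integral_trace_mul_inv_mul_trace_mul ρ hρ,
    integral_trace_mul_inv_mul_conj_trace_mul ρ hρ hN, Complex.zero_re, add_zero, Complex.mul_re,
    Complex.inv_re, Complex.inv_im, Complex.natCast_re, Complex.natCast_im, Complex.normSq_natCast]
  have hN0 : (N : ℝ) ≠ 0 := by exact_mod_cast (show N ≠ 0 by omega)
  field_simp
  ring

/-- **Real convolution identity, `N = 2`**: `∫ Re χ(x g⁻¹) Re χ(g y) dg = Re χ(x y)/2` (the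
character of `SU(2)` is real). -/
theorem integral_re_trace_mul_inv_mul_of_two {G : Type*} [Group G] [TopologicalSpace G]
    [IsTopologicalGroup G] [CompactSpace G] [MeasurableSpace G] [BorelSpace G]
    (ρ : G →* Matrix (Fin 2) (Fin 2) ℂ) (hρ : IsSpecialUnitaryModel ρ) (x y : G) :
    ∫ g, ((ρ (x * g⁻¹)).trace).re * ((ρ (g * y)).trace).re ∂haarProbability G =
      (2 : ℝ)⁻¹ * ((ρ (x * y)).trace).re := by
  have him : ∀ h : G, ((ρ h).trace).im = 0 := fun h => by
    have := congrArg Complex.im (conj_trace_eq_of_two ρ hρ h)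
    rw [Complex.conj_im] at this
    linarith
  have hpt : ∀ g : G, ((ρ (x * g⁻¹)).trace).re * ((ρ (g * y)).trace).re =
      ((ρ (x * g⁻¹)).trace * (ρ (g * y)).trace).re := fun g => by
    rw [Complex.mul_re, him, him, mul_zero, sub_zero]
  have hc1 : Continuous fun g : G => (ρ (x * g⁻¹)).trace * (ρ (g * y)).trace :=
    (hρ.1.matrix_trace.comp (continuous_const.mul continuous_inv)).mul
      (hρ.1.matrix_trace.comp (continuous_id.mul continuous_const))
  have hre1 := integral_re (𝕜 := ℂ) (integrable_of_continuous hc1)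
  simp only [RCLike.re_to_complex] at hre1
  simp_rw [hpt]
  rw [hre1, integral_trace_mul_inv_mul_trace_mul ρ hρ, Complex.mul_re, Complex.inv_re,
    Complex.inv_im, Complex.natCast_re, Complex.natCast_im, Complex.normSq_natCast]
  push_cast
  ring

/-- ★ **The real convolution identity with a positive constant**: for `G ≅ SU(N)`, `N ≥ 2`,
there is `c₁ > 0` (`1/2` for `N = 2`, `1/(2N)` for `N ≥ 3`) with
`∫ Re χ(x g⁻¹) Re χ(g y) dg = c₁ Re χ(x y)` for all `x, y`. -/
theorem exists_re_conv_const (hρ : IsSpecialUnitaryModel ρ) (hN : 2 ≤ N) :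
    ∃ c₁ : ℝ, 0 < c₁ ∧ ∀ x y : G,
      ∫ g, ((ρ (x * g⁻¹)).trace).re * ((ρ (g * y)).trace).re ∂haarProbability G =
        c₁ * ((ρ (x * y)).trace).re := by
  rcases Nat.lt_or_ge N 3 with h3 | h3
  · obtain rfl : N = 2 := by omega
    exact ⟨2⁻¹, by norm_num, integral_re_trace_mul_inv_mul_of_two ρ hρ⟩
  · exact ⟨(2 * N : ℝ)⁻¹, by positivity, integral_re_trace_mul_inv_mul_of_three_le ρ hρ h3⟩

end DiagRPSUN

end Summit.QuantumFields.GaugeBoot
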